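import Summits.QuantumFields.YangMills.Theorems.BalabanUVNodesN17RunRemAtOfShiftAnchorLevel
import Mathlib.Analysis.Asymptotics.SpecificAsymptotics

/-!
# NODE N17 (NE4) — SUPPLIER ROAD TO K2⁷, FILE 3: GIVEN N17 AND THE ANCHOR, THE NAMED ONE-LOOP NUMBERS `beta0OfJs F κ` CONVERGE, AND ROW (D1) AT THE ANCHORING κ (the registered
# 1ᴬ's conclusion `∃ A, OneLoopDrift (stepBal 2 F.L) A (beta0OfJs F κ)`) IS EXACTLY «their limit is Bałaban's slope `stepBal 2 F.L`»; the K2⁷ decl from N17 + ONE located text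

Cell `pub-ymgap`, YM-PLAN Track A (HUMAN RULINGS D-0062 ∕ D-0149), WIDTH SEAT `pub-ymgap-dag-n17-w1` (generation 3), third module.  Key K3⁷ stmt-QuantumFields-20544
(`--kind proof --supports 20544 --as helper`, COUNT-NEUTRAL); via node N17 also K2⁷ stmt-QuantumFields-20543 (skeleton v6 5a75a2378c79b303: 1ᴬ `stub_d1AnchoredJets13 : D1AtAnchoredJets`,
2ᴮ″ `stub_runRemNamedJets13 : RunRemAtSomeJets`).  Continues FILE 1 (p600401; split-free lever, `RunRemAt` from N17 + anchor + (C)) and FILE 2 (`…Level`: (C) at ONE level; 2ᴮ″ ⟺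
anchor ∧ one-level (C) GIVEN N17).  THIS FILE does for 1ᴬ what FILE 2 did for 2ᴮ″.

THE POINT.  FILE 1's `conv_beta0OfJs_of_n17At_scaleAnchor`: N17 on the datum of record (`0 ≤ u.ρ < 1`, window `θ.γ`) + DEF-1's anchor at `θ.cβ • beta0OfJs F κ` ⟹ the scaled named numbers
converge GEOMETRICALLY.  Dividing by `θ.cβ > 0` (`Admissible.chart`): the bare named numbers `b_k := beta0OfJs F κ k` converge geometrically to some `L` (★ `exists_lim_beta0OfJs_of_n17At_scaleAnchor`
— the EXISTENCE of the limit of the named one-loop numbers is node N17's + the anchor's).  Two elementary facts about DEF-1's ∕ the β sub-cell's drift shape `OneLoopDrift s A b`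
(`|Σ_{j<k} b_j − s·k| ≤ A`): geometric convergence to `L` gives a drift with slope `L` (`oneLoopDrift_of_abs_sub_le_geometric`, the deviations are absolutely summable), and a drift of a
convergent sequence has the limit as its slope (`slope_eq_lim_of_oneLoopDrift`, Cesàro — Mathlib's `Filter.Tendsto.cesaro`).  Hence (★★★ `exists_oneLoopDrift_iff_tendsto_stepBal_of_n17At_scaleAnchor`)
GIVEN N17 and the anchor at κ:   `(∃ A, OneLoopDrift (stepBal 2 F.L) A (beta0OfJs F κ))  ⟺  Tendsto (beta0OfJs F κ) atTop (𝓝 (stepBal 2 F.L))`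
— row (D1) at the anchoring colour datum, i.e. the registered 1ᴬ's conclusion, is EXACTLY «the named one-loop numbers tend to the asymptotic-freedom slope» ((AF-0∞)'s VALUE for the
named jets).  Text level (K2⁷ v6's full prefix): GIVEN the `N17AtRecord13` text, the REGISTERED 1ᴬ text ⟺ the text «at every anchoring κ, `beta0OfJs F κ → stepBal 2 F.L`»
(`d1AtAnchoredJets_iff_limitAtAnchoredJets_of_n17AtRecord13`); and the crux decl `EndpointGivenBR13SepCoPH` BY NAME from the N17 text + the ONE located text «∃ κ, ScaleAnchor ∧ (∃ γ₀ > 0,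
SurvCont γ₀) ∧ Tendsto (beta0OfJs F κ) atTop (𝓝 (stepBal 2 F.L))» (`EndpointGivenBR13SepCoPH_of_n17AtRecord13_anchorSurvLimit`).  SO, MODULO NODE N17 (END-free), THE WHOLE OF K2⁷ IS:
identification (anchor) + survivor continuity at one level + the VALUE `stepBal 2 F.L` of the limit of the named numbers — the last being the β sub-cell's ∕ NODE O's row (D1) wall in its
plainest form.  (Under K3⁷ v4, whose `KeyedRatesHolderD4` is keyed GIVEN the endpoint, K3's stub 1 cannot be this N17 supplier for K2⁷; END-free N17 roads are the n17∕n18 lanes'.)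

WHAT THIS FILE PROVES (theorems only; 0 `def`, 0 `instance`, 0 `sorry`): §1 generic (`b : ℕ → ℝ`) `oneLoopDrift_of_abs_sub_le_geometric`, `slope_eq_lim_of_oneLoopDrift`, `exists_oneLoopDrift_iff_eq_lim`;
§2 (N = 2, `datumOfRecord₁₃SepCoPH`) ★ `exists_lim_beta0OfJs_of_n17At_scaleAnchor`, ★★ `exists_oneLoopDrift_iff_tendsto_of_n17At_scaleAnchor` (κ-free corner form: any anchoring `b`
converges and drifts with slope `s` iff `b → s`), ★★★ `exists_oneLoopDrift_iff_tendsto_stepBal_of_n17At_scaleAnchor`; §3 (texts inline) ★★★ `d1AtAnchoredJets_iff_limitAtAnchoredJets_of_n17AtRecord13`,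
★★ `cornerDrift_iff_cornerLimit_of_n17AtRecord13` (DEF-1's κ-free corner-drift text ⟺ the corner-LIMIT text, given N17), ★★★ `EndpointGivenBR13SepCoPH_of_n17AtRecord13_anchorSurvLimit`.  DEF-1's `ScaleAnchor` ∕ `RunRemAt` ∕ `SurvCont` ∕ `beta0OfJs` ∕
`endpointExistence_of_runRemAt_drift`, the β sub-cell's `Beta.Drift.OneLoopDrift`, FILE 1 ∕ FILE 2 BY NAME; nothing restated.

HONEST SCOPE (A6, director-ym №189).  Elementary real analysis over hypothesis SHAPES; §2–§3 quantify over `θ : Stage13HParams F 2` with `hP : θ.Provisos₁₃SepCoPH F 2` — inhabited iff K0⁷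
(stmt-QuantumFields-20541).  NOTHING of Bałaban is asserted or instantiated: NE4 NOT IN PRINT ([Balaban1987RG1] p. 264; GAPS G-t4-U2-1) and NOT proved; the anchor's identification, (C), row (D1)
and the VALUE of the named limit NOT proved (the β sub-cell's wall); NOT a proof of `stub_d1AnchoredJets13`, `stub_runRemNamedJets13`, `stub_rates13H` or any stub; N17 NOT discharged
(DEPENDENT∕DERIVED row); K2⁷ ∕ K3⁷ OPEN; counts UNMOVED (typed 28∕28 · discharged 5∕27 · A 5∕28).  One finite four-torus programme at fixed `ε = L^{−K}`, Bałaban AS PRINTED; the YM mass gap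
(Clay) is NOT proved by any of this — R4 closes the conditional finite-𝕋⁴ rung `BalabanLadder.UV` only; nothing continuum ∕ ℝ⁴ ∕ OS.  No `instance`, no `notation`, no `axiom`.
[I] = [Balaban1987RG1] T. Bałaban, CMP **109** (1987): Thm 2 p. 259, (1.3)–(1.4) p. 260, (1.20)–(1.22) p. 264, Thm 3 p. 264, (2.12)–(2.14) p. 268.
-/

noncomputable section

namespace Summit.QuantumFields.YangMills.BalabanUVNodes.N17D1OfNamedLimit

open Literature.MathematicalPhysics.QuantumFieldTheory.Balaban1983to89
open Literature.MathematicalPhysics.QuantumFieldTheory.Balaban1983to89.FlowStep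
open Literature.MathematicalPhysics.QuantumFieldTheory.Balaban1983to89.T4CouplingMatching (ScaleShiftRate)
open Literature.MathematicalPhysics.QuantumFieldTheory.Balaban1983to89.DagBinding (EndpointExistence ForwardGenerated)
open Literature.MathematicalPhysics.QuantumFieldTheory.Balaban1983to89.T4Continuum (T4Family)
open Literature.MathematicalPhysics.QuantumFieldTheory.Balaban1983to89.Beta.Drift (OneLoopDrift)
open Summit.QuantumFields.YangMills.Theorems.BalabanUVNodesK2JsOfRecord (StepColourData beta0OfJs stepBal_L_pos)
open Summit.QuantumFields.YangMills.Theorems.BalabanUVNodesK2NamedJetsRemAt (ScaleAnchor)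
open Summit.QuantumFields.YangMills.Theorems.BalabanUVNodesK2NamedJetsRunRemAt (RunRemAt SurvCont endpointExistence_of_runRemAt_drift)
open Summit.QuantumFields.YangMills.BalabanUVNodes.N17RunRemAtOfShiftAnchor (cβ_mul_stepBal_pos conv_beta0OfJs_of_n17At_scaleAnchor conv_of_scaleShiftRate_scaleAnchor
  scaleShiftRate_of_n17At_window)
open Summit.QuantumFields.YangMills.BalabanUVNodes.N17RunRemAtOfShiftAnchorLevel (runRemAt_of_n17At_scaleAnchor_survContAt)
open Finset Filter Topology

/-! ## §1 Generic: a drift is the statement «the slope is the limit» for geometrically convergent numbers -/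

section Generic

variable {b : ℕ → ℝ}

/-- **GEOMETRIC CONVERGENCE ⟹ DRIFT AT THE LIMIT**: `|b_k − L| ≤ C·ρ^k` (`0 ≤ ρ < 1`) ⟹ `OneLoopDrift L (C∕(1−ρ)) b`, i.e. `|Σ_{j<k} b_j − L·k| ≤ C∕(1−ρ)` for all `k`
(the deviations are absolutely summable). [folklore] -/
theorem oneLoopDrift_of_abs_sub_le_geometric {L C ρ : ℝ} (hρ0 : 0 ≤ ρ) (hρ1 : ρ < 1) (h : ∀ k, |b k - L| ≤ C * ρ ^ k) :
    OneLoopDrift L (C / (1 - ρ)) b := by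
  intro k
  have hC : 0 ≤ C := by simpa using (abs_nonneg _).trans (h 0)
  have e : ∑ j ∈ range k, b j - L * k = ∑ j ∈ range k, (b j - L) := by
    rw [Finset.sum_sub_distrib, Finset.sum_const, Finset.card_range, nsmul_eq_mul]; ring
  rw [e]
  calc |∑ j ∈ range k, (b j - L)| ≤ ∑ j ∈ range k, |b j - L| := Finset.abs_sum_le_sum_abs _ _
    _ ≤ ∑ j ∈ range k, C * ρ ^ j := Finset.sum_le_sum fun j _ => h j
    _ = C * ∑ j ∈ range k, ρ ^ j := by rw [Finset.mul_sum]
    _ ≤ C * (∑' j, ρ ^ j) :=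
        mul_le_mul_of_nonneg_left ((summable_geometric_of_lt_one hρ0 hρ1).sum_le_tsum (range k) fun j _ => pow_nonneg hρ0 j) hC
    _ = C / (1 - ρ) := by rw [tsum_geometric_of_lt_one hρ0 hρ1, div_eq_mul_inv]

/-- **A DRIFT OF A CONVERGENT SEQUENCE HAS THE LIMIT AS ITS SLOPE**: `OneLoopDrift s A b` and `b_k → L` ⟹ `s = L` (the Cesàro means tend to `L`, and the drift pins them
within `A∕k` of `s`). [folklore] -/
theorem slope_eq_lim_of_oneLoopDrift {s A L : ℝ} (hd : OneLoopDrift s A b) (hb : Tendsto b atTop (𝓝 L)) : s = L := by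
  have hces : Tendsto (fun n : ℕ => (n⁻¹ : ℝ) * ∑ i ∈ range n, b i) atTop (𝓝 L) := hb.cesaro
  have hs : Tendsto (fun n : ℕ => (n⁻¹ : ℝ) * ∑ i ∈ range n, b i) atTop (𝓝 s) := by
    have h0 : Tendsto (fun n : ℕ => (n⁻¹ : ℝ) * ∑ i ∈ range n, b i - s) atTop (𝓝 0) := by
      have hlim0 : Tendsto (fun n : ℕ => A * (n : ℝ)⁻¹) atTop (𝓝 0) := by
        simpa using (tendsto_const_nhds (x := A)).mul (tendsto_inv_atTop_nhds_zero_nat (𝕜 := ℝ))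
      refine squeeze_zero_norm' ?_ hlim0
      filter_upwards [eventually_ge_atTop 1] with n hn
      have hn0 : (n : ℝ) ≠ 0 := by exact_mod_cast (Nat.one_le_iff_ne_zero.mp hn)
      have hnpos : 0 < (n : ℝ) := by exact_mod_cast hn
      have e : (n⁻¹ : ℝ) * ∑ i ∈ range n, b i - s = (∑ i ∈ range n, b i - s * n) * (n : ℝ)⁻¹ := by field_simp
      rw [Real.norm_eq_abs, e, abs_mul, abs_inv, abs_of_pos hnpos]
      exact mul_le_mul_of_nonneg_right (hd n) (inv_nonneg.mpr hnpos.le)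
    have := h0.add_const s
    simpa using this
  exact tendsto_nhds_unique hs hces

/-- **UNDER GEOMETRIC CONVERGENCE TO `L`, «a drift with slope `s` exists» ⟺ `s = L`.** [folklore] -/
theorem exists_oneLoopDrift_iff_eq_lim {L C ρ s : ℝ} (hρ0 : 0 ≤ ρ) (hρ1 : ρ < 1) (h : ∀ k, |b k - L| ≤ C * ρ ^ k) (hb : Tendsto b atTop (𝓝 L)) :
    (∃ A : ℝ, OneLoopDrift s A b) ↔ s = L :=
  ⟨fun ⟨_, hd⟩ => slope_eq_lim_of_oneLoopDrift hd hb, fun hs => ⟨C / (1 - ρ), hs ▸ oneLoopDrift_of_abs_sub_le_geometric hρ0 hρ1 h⟩⟩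

end Generic

/-! ## §2 At NODE 00's Stage-13 record (`N = 2`): node N17 + the anchor ⟹ the NAMED numbers converge; row (D1) at the anchoring κ ⟺ «their limit is `stepBal 2 F.L`» -/

section Record

open YMDAG.UVSplit (U3Carriers N17At)

variable (F : T4Family) (κ : StepColourData) (θ : Node00.Stage13HParams F 2) (hP : θ.Provisos₁₃SepCoPH F 2)

/-- **NODE N17 + THE ANCHOR ⟹ THE BARE NAMED NUMBERS `beta0OfJs F κ` CONVERGE GEOMETRICALLY** to some `L`, `|b_k − L| ≤ (c∕(1−u.ρ)∕θ.cβ)·u.ρ^k` with `c := u.cr·u.C₅·u.θ` (FILE 1's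
`conv_beta0OfJs_of_n17At_scaleAnchor` divided by `θ.cβ > 0`, `Admissible.chart`).  The EXISTENCE of the limit of the named one-loop numbers is thus node N17's + the anchor's;
its VALUE is not touched.  CONDITIONAL. [cite: Balaban1987RG1, (1.20)-(1.22) p.264 and (2.12)-(2.14) p.268] -/
theorem exists_lim_beta0OfJs_of_n17At_scaleAnchor (hθ : θ.Admissible F 2) {u : U3Carriers} (hγu : u.γ = θ.γ) (hρ1 : u.ρ < 1)
    (h17 : N17At (Node00.datumOfRecord₁₃SepCoPH F 2 θ hP) u)
    (hA : ScaleAnchor (Node00.datumOfRecord₁₃SepCoPH F 2 θ hP).βfun (fun k => θ.cβ * beta0OfJs F κ k)) :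
    ∃ L : ℝ, Tendsto (beta0OfJs F κ) atTop (𝓝 L) ∧ ∀ k, |beta0OfJs F κ k - L| ≤ u.cr * u.C₅ * u.θ / (1 - u.ρ) / θ.cβ * u.ρ ^ k := by
  have hc : 0 < θ.cβ := hθ.toStage9.chart.1
  obtain ⟨binf, hT, hbd⟩ := conv_beta0OfJs_of_n17At_scaleAnchor F κ θ hP hθ hγu hρ1 h17 hA
  refine ⟨binf / θ.cβ, ?_, fun k => ?_⟩
  · have := hT.const_mul θ.cβ⁻¹
    simp only [inv_mul_cancel_left₀ hc.ne'] at this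
    simpa [div_eq_inv_mul] using this
  · have e : beta0OfJs F κ k - binf / θ.cβ = (θ.cβ * beta0OfJs F κ k - binf) / θ.cβ := by field_simp
    rw [e, abs_div, abs_of_pos hc, div_le_iff₀ hc]
    calc |θ.cβ * beta0OfJs F κ k - binf| ≤ u.cr * u.C₅ * u.θ / (1 - u.ρ) * u.ρ ^ k := hbd k
      _ = u.cr * u.C₅ * u.θ / (1 - u.ρ) / θ.cβ * u.ρ ^ k * θ.cβ := by field_simp

/-- ★★ **κ-FREE, JETS-FREE CORNER FORM: GIVEN NODE N17, ANY sequence `b` ANCHORING the record's β (`ScaleAnchor D.βfun b` — the per-scale zero-history LIMITS of `β_{k+1}`, unique when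
they exist, DEF-1's `ScaleAnchor.eq`) CONVERGES geometrically, and «`b` drifts with slope `s`» ⟺ «`b_k → s`»** — for every `s`.  At `s := θ.cβ · stepBal 2 F.L` the left side is the hypothesis of
DEF-1's κ-free use form `d1AtAnchoredJets_of_cornerDrift` (INTENT-5 `…K2V6Defs`), so modulo N17 that corner drift IS the double-limit statement «lim_k lim_{p→0⁺} β_{k+1}(p) = θ.cβ · stepBal 2 F.L»
((AF-0∞) for the record's OWN β; no `JsOfRecord`, no (P6), no κ).  CONDITIONAL. [cite: Balaban1987RG1, (1.3) p.260, (1.20)-(1.22) p.264 and (2.12)-(2.14) p.268] -/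
theorem exists_oneLoopDrift_iff_tendsto_of_n17At_scaleAnchor (hθ : θ.Admissible F 2) {u : U3Carriers} (hγu : u.γ = θ.γ) (hρ0 : 0 ≤ u.ρ) (hρ1 : u.ρ < 1)
    (h17 : N17At (Node00.datumOfRecord₁₃SepCoPH F 2 θ hP) u) {b : ℕ → ℝ} (hA : ScaleAnchor (Node00.datumOfRecord₁₃SepCoPH F 2 θ hP).βfun b) (s : ℝ) :
    (∃ L : ℝ, Tendsto b atTop (𝓝 L) ∧ ∀ k, |b k - L| ≤ u.cr * u.C₅ * u.θ / (1 - u.ρ) * u.ρ ^ k) ∧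
      ((∃ A : ℝ, OneLoopDrift s A b) ↔ Tendsto b atTop (𝓝 s)) := by
  have hγ : 0 < θ.γ := hθ.toStage12.toStage9.gamma_pos
  obtain ⟨L, hT, hbd⟩ := conv_of_scaleShiftRate_scaleAnchor hγ hρ1 hA (scaleShiftRate_of_n17At_window F θ hP hγu h17)
  refine ⟨⟨L, hT, hbd⟩, ?_, fun hlim => ?_⟩
  · rintro ⟨A, hd⟩
    rwa [slope_eq_lim_of_oneLoopDrift hd hT]
  · exact (exists_oneLoopDrift_iff_eq_lim hρ0 hρ1 hbd hT).2 (tendsto_nhds_unique hlim hT)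

/-- ★★★ **GIVEN NODE N17 AND THE ANCHOR AT κ, ROW (D1) AT κ — the registered 1ᴬ's conclusion `∃ A, OneLoopDrift (stepBal 2 F.L) A (beta0OfJs F κ)` — IS EXACTLY «THE NAMED
ONE-LOOP NUMBERS TEND TO BAŁABAN's ASYMPTOTIC-FREEDOM SLOPE `stepBal 2 F.L`»** ((AF-0∞)'s VALUE for the named jets; the limit EXISTS by the previous theorem).  (→: a drift of a
convergent sequence has the limit as slope, Cesàro; ←: geometric convergence sums.)  CONDITIONAL; row (D1) ∕ the limit's value NOT proved.
[cite: Balaban1987RG1, (1.3) p.260, (1.20)-(1.22) p.264 and (2.12)-(2.14) p.268] -/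
theorem exists_oneLoopDrift_iff_tendsto_stepBal_of_n17At_scaleAnchor (hθ : θ.Admissible F 2) {u : U3Carriers} (hγu : u.γ = θ.γ) (hρ0 : 0 ≤ u.ρ) (hρ1 : u.ρ < 1)
    (h17 : N17At (Node00.datumOfRecord₁₃SepCoPH F 2 θ hP) u)
    (hA : ScaleAnchor (Node00.datumOfRecord₁₃SepCoPH F 2 θ hP).βfun (fun k => θ.cβ * beta0OfJs F κ k)) :
    (∃ A : ℝ, OneLoopDrift (B12Normalization.stepBal 2 F.L) A (beta0OfJs F κ)) ↔
      Tendsto (beta0OfJs F κ) atTop (𝓝 (B12Normalization.stepBal 2 F.L)) := by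
  obtain ⟨L, hT, hbd⟩ := exists_lim_beta0OfJs_of_n17At_scaleAnchor F κ θ hP hθ hγu hρ1 h17 hA
  constructor
  · rintro ⟨A, hd⟩
    rwa [slope_eq_lim_of_oneLoopDrift hd hT]
  · intro hlim
    have hL : B12Normalization.stepBal 2 F.L = L := tendsto_nhds_unique hlim hT
    exact (exists_oneLoopDrift_iff_eq_lim hρ0 hρ1 hbd hT).2 hL

end Record

/-! ## §3 Text level (K2⁷ v6's full prefix; `Window13` spelled as the crux decl spells it): 1ᴬ ⟺ «the named limit is the slope» GIVEN N17; the K2⁷ decl from the N17 text +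
ONE located text «∃ κ: anchor ∧ one-level (C) ∧ lim = stepBal 2 F.L» -/

section Texts

open YMDAG.UVSplit (U3Carriers N17At)

/-- ★★★ **GIVEN THE `N17AtRecord13` TEXT, THE REGISTERED 1ᴬ TEXT `D1AtAnchoredJets` IS EQUIVALENT TO THE TEXT «at every anchoring κ the named numbers tend to `stepBal 2 F.L`»**
(both under K2⁷ v6's full prefix + the anchor hypothesis).  CONDITIONAL; NOT a proof of `stub_d1AnchoredJets13`. [cite: Balaban1987RG1, (1.3) p.260 and (2.12)-(2.14) p.268] -/
theorem d1AtAnchoredJets_iff_limitAtAnchoredJets_of_n17AtRecord13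
    (hN : ∀ (F : T4Family) (θ : Node00.Stage13HParams F 2) (hP : θ.Provisos₁₃SepCoPH F 2), (θ.ZhUnity F 2 ∧ θ.SlotsNondegenerate₁₃ F 2) → θ.Admissible F 2 →
      B16.EndStatementBPrinted (Node00.datumOfRecord₁₃SepCoPH F 2 θ hP).C →
      (∃ γ₁ : ℝ, 0 < γ₁ ∧ ∀ γ : ℝ, 0 < γ → γ ≤ γ₁ → ∃ P : B12.RunParams, 1 ≤ P.K ∧ ((Node00.datumOfRecord₁₃SepCoPH F 2 θ hP).C P).flow.InInterval γ P.K) →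
      ∃ u : U3Carriers, u.γ = θ.γ ∧ 0 ≤ u.ρ ∧ u.ρ < 1 ∧ N17At (Node00.datumOfRecord₁₃SepCoPH F 2 θ hP) u) :
    (∀ (F : T4Family) (κ : StepColourData) (θ : Node00.Stage13HParams F 2) (hP : θ.Provisos₁₃SepCoPH F 2), (θ.ZhUnity F 2 ∧ θ.SlotsNondegenerate₁₃ F 2) →
      θ.Admissible F 2 → B16.EndStatementBPrinted (Node00.datumOfRecord₁₃SepCoPH F 2 θ hP).C →
      (∃ γ₁ : ℝ, 0 < γ₁ ∧ ∀ γ : ℝ, 0 < γ → γ ≤ γ₁ → ∃ P : B12.RunParams, 1 ≤ P.K ∧ ((Node00.datumOfRecord₁₃SepCoPH F 2 θ hP).C P).flow.InInterval γ P.K) →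
      ScaleAnchor (Node00.datumOfRecord₁₃SepCoPH F 2 θ hP).βfun (fun k => θ.cβ * beta0OfJs F κ k) →
      ∃ A : ℝ, OneLoopDrift (B12Normalization.stepBal 2 F.L) A (beta0OfJs F κ)) ↔
    (∀ (F : T4Family) (κ : StepColourData) (θ : Node00.Stage13HParams F 2) (hP : θ.Provisos₁₃SepCoPH F 2), (θ.ZhUnity F 2 ∧ θ.SlotsNondegenerate₁₃ F 2) →
      θ.Admissible F 2 → B16.EndStatementBPrinted (Node00.datumOfRecord₁₃SepCoPH F 2 θ hP).C →
      (∃ γ₁ : ℝ, 0 < γ₁ ∧ ∀ γ : ℝ, 0 < γ → γ ≤ γ₁ → ∃ P : B12.RunParams, 1 ≤ P.K ∧ ((Node00.datumOfRecord₁₃SepCoPH F 2 θ hP).C P).flow.InInterval γ P.K) →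
      ScaleAnchor (Node00.datumOfRecord₁₃SepCoPH F 2 θ hP).βfun (fun k => θ.cβ * beta0OfJs F κ k) →
      Tendsto (beta0OfJs F κ) atTop (𝓝 (B12Normalization.stepBal 2 F.L))) := by
  constructor
  · intro h F κ θ hP hU hθ hB hwin hA
    obtain ⟨u, hγu, hρ0, hρ1, h17⟩ := hN F θ hP hU hθ hB hwin
    exact (exists_oneLoopDrift_iff_tendsto_stepBal_of_n17At_scaleAnchor F κ θ hP hθ hγu hρ0 hρ1 h17 hA).1 (h F κ θ hP hU hθ hB hwin hA)
  · intro h F κ θ hP hU hθ hB hwin hA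
    obtain ⟨u, hγu, hρ0, hρ1, h17⟩ := hN F θ hP hU hθ hB hwin
    exact (exists_oneLoopDrift_iff_tendsto_stepBal_of_n17At_scaleAnchor F κ θ hP hθ hγu hρ0 hρ1 h17 hA).2 (h F κ θ hP hU hθ hB hwin hA)

/-- ★★ **GIVEN THE `N17AtRecord13` TEXT, THE κ-FREE CORNER-DRIFT TEXT (the hypothesis of DEF-1's `d1AtAnchoredJets_of_cornerDrift`: «at every tuple carrying the crux's hypotheses, every
sequence anchoring the record's β drifts with slope `θ.cβ · stepBal 2 F.L`») IS EQUIVALENT TO THE CORNER-LIMIT TEXT «… every anchoring sequence tends to `θ.cβ · stepBal 2 F.L`»** — row (D1)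
for the record's own β as a double limit, jets-free.  CONDITIONAL. [cite: Balaban1987RG1, (1.3) p.260 and (2.12)-(2.14) p.268] -/
theorem cornerDrift_iff_cornerLimit_of_n17AtRecord13
    (hN : ∀ (F : T4Family) (θ : Node00.Stage13HParams F 2) (hP : θ.Provisos₁₃SepCoPH F 2), (θ.ZhUnity F 2 ∧ θ.SlotsNondegenerate₁₃ F 2) → θ.Admissible F 2 →
      B16.EndStatementBPrinted (Node00.datumOfRecord₁₃SepCoPH F 2 θ hP).C →
      (∃ γ₁ : ℝ, 0 < γ₁ ∧ ∀ γ : ℝ, 0 < γ → γ ≤ γ₁ → ∃ P : B12.RunParams, 1 ≤ P.K ∧ ((Node00.datumOfRecord₁₃SepCoPH F 2 θ hP).C P).flow.InInterval γ P.K) →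
      ∃ u : U3Carriers, u.γ = θ.γ ∧ 0 ≤ u.ρ ∧ u.ρ < 1 ∧ N17At (Node00.datumOfRecord₁₃SepCoPH F 2 θ hP) u) :
    (∀ (F : T4Family) (θ : Node00.Stage13HParams F 2) (hP : θ.Provisos₁₃SepCoPH F 2), (θ.ZhUnity F 2 ∧ θ.SlotsNondegenerate₁₃ F 2) → θ.Admissible F 2 →
      B16.EndStatementBPrinted (Node00.datumOfRecord₁₃SepCoPH F 2 θ hP).C →
      (∃ γ₁ : ℝ, 0 < γ₁ ∧ ∀ γ : ℝ, 0 < γ → γ ≤ γ₁ → ∃ P : B12.RunParams, 1 ≤ P.K ∧ ((Node00.datumOfRecord₁₃SepCoPH F 2 θ hP).C P).flow.InInterval γ P.K) →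
      ∀ b : ℕ → ℝ, ScaleAnchor (Node00.datumOfRecord₁₃SepCoPH F 2 θ hP).βfun b → ∃ A : ℝ, OneLoopDrift (θ.cβ * B12Normalization.stepBal 2 F.L) A b) ↔
    (∀ (F : T4Family) (θ : Node00.Stage13HParams F 2) (hP : θ.Provisos₁₃SepCoPH F 2), (θ.ZhUnity F 2 ∧ θ.SlotsNondegenerate₁₃ F 2) → θ.Admissible F 2 →
      B16.EndStatementBPrinted (Node00.datumOfRecord₁₃SepCoPH F 2 θ hP).C →
      (∃ γ₁ : ℝ, 0 < γ₁ ∧ ∀ γ : ℝ, 0 < γ → γ ≤ γ₁ → ∃ P : B12.RunParams, 1 ≤ P.K ∧ ((Node00.datumOfRecord₁₃SepCoPH F 2 θ hP).C P).flow.InInterval γ P.K) →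
      ∀ b : ℕ → ℝ, ScaleAnchor (Node00.datumOfRecord₁₃SepCoPH F 2 θ hP).βfun b → Tendsto b atTop (𝓝 (θ.cβ * B12Normalization.stepBal 2 F.L))) := by
  constructor
  · intro h F θ hP hU hθ hB hwin b hA
    obtain ⟨u, hγu, hρ0, hρ1, h17⟩ := hN F θ hP hU hθ hB hwin
    exact (exists_oneLoopDrift_iff_tendsto_of_n17At_scaleAnchor F θ hP hθ hγu hρ0 hρ1 h17 hA _).2.1 (h F θ hP hU hθ hB hwin b hA)
  · intro h F θ hP hU hθ hB hwin b hA
    obtain ⟨u, hγu, hρ0, hρ1, h17⟩ := hN F θ hP hU hθ hB hwin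
    exact (exists_oneLoopDrift_iff_tendsto_of_n17At_scaleAnchor F θ hP hθ hγu hρ0 hρ1 h17 hA _).2.2 (h F θ hP hU hθ hB hwin b hA)

/-- ★★★ **THE K2⁷ CRUX DECL BY NAME FROM THE `N17AtRecord13` TEXT + ONE LOCATED TEXT «at every tuple SOME colour datum κ ANCHORS the record's β, with survivor continuity at one positive
level, and its named one-loop numbers tend to `stepBal 2 F.L`»** — per tuple: the run letter from FILE 2's one-level junction, the drift from §2 (←), DEF-1's `endpointExistence_of_runRemAt_drift`.
THE LOCATED RESIDUE OF K2⁷ MODULO NODE N17 (END-free): identification + (C) at one level + the VALUE of the named limit ((AF-0∞) ∕ row (D1) at the anchoring κ).  CONDITIONAL on both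
displayed hypotheses; K2⁷ NOT closed; nothing of Bałaban asserted. [cite: Balaban1987RG1, Thm 2 p.259 (first sentence), (1.3) p.260, (1.20)-(1.22) p.264 and (2.12)-(2.14) p.268] -/
theorem EndpointGivenBR13SepCoPH_of_n17AtRecord13_anchorSurvLimit
    (hN : ∀ (F : T4Family) (θ : Node00.Stage13HParams F 2) (hP : θ.Provisos₁₃SepCoPH F 2), (θ.ZhUnity F 2 ∧ θ.SlotsNondegenerate₁₃ F 2) → θ.Admissible F 2 →
      B16.EndStatementBPrinted (Node00.datumOfRecord₁₃SepCoPH F 2 θ hP).C →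
      (∃ γ₁ : ℝ, 0 < γ₁ ∧ ∀ γ : ℝ, 0 < γ → γ ≤ γ₁ → ∃ P : B12.RunParams, 1 ≤ P.K ∧ ((Node00.datumOfRecord₁₃SepCoPH F 2 θ hP).C P).flow.InInterval γ P.K) →
      ∃ u : U3Carriers, u.γ = θ.γ ∧ 0 ≤ u.ρ ∧ u.ρ < 1 ∧ N17At (Node00.datumOfRecord₁₃SepCoPH F 2 θ hP) u)
    (hASL : ∀ (F : T4Family) (θ : Node00.Stage13HParams F 2) (hP : θ.Provisos₁₃SepCoPH F 2), (θ.ZhUnity F 2 ∧ θ.SlotsNondegenerate₁₃ F 2) → θ.Admissible F 2 →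
      B16.EndStatementBPrinted (Node00.datumOfRecord₁₃SepCoPH F 2 θ hP).C →
      (∃ γ₁ : ℝ, 0 < γ₁ ∧ ∀ γ : ℝ, 0 < γ → γ ≤ γ₁ → ∃ P : B12.RunParams, 1 ≤ P.K ∧ ((Node00.datumOfRecord₁₃SepCoPH F 2 θ hP).C P).flow.InInterval γ P.K) →
      ∃ κ : StepColourData, ScaleAnchor (Node00.datumOfRecord₁₃SepCoPH F 2 θ hP).βfun (fun k => θ.cβ * beta0OfJs F κ k) ∧
        (∃ γ₀ : ℝ, 0 < γ₀ ∧ SurvCont (Node00.datumOfRecord₁₃SepCoPH F 2 θ hP).βfun γ₀) ∧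
        Tendsto (beta0OfJs F κ) atTop (𝓝 (B12Normalization.stepBal 2 F.L))) :
    Summit.QuantumFields.YangMills.Theses.BalabanUVNodes.EndpointGivenBR13SepCoPH := by
  intro F θ hP hU hθ hB hwin
  obtain ⟨u, hγu, hρ0, hρ1, h17⟩ := hN F θ hP hU hθ hB hwin
  obtain ⟨κ, hA, ⟨γ₀, hγ₀, hsc⟩, hlim⟩ := hASL F θ hP hU hθ hB hwin
  have hRun : RunRemAt F κ θ hP θ.cβ := runRemAt_of_n17At_scaleAnchor_survContAt F κ θ hP hθ hγu hρ0 hρ1 h17 hA hγ₀ hsc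
  obtain ⟨A, hdrift⟩ := (exists_oneLoopDrift_iff_tendsto_stepBal_of_n17At_scaleAnchor F κ θ hP hθ hγu hρ0 hρ1 h17 hA).2 hlim
  exact endpointExistence_of_runRemAt_drift F κ θ hP hRun hdrift

end Texts

end Summit.QuantumFields.YangMills.BalabanUVNodes.N17D1OfNamedLimit

end
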